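import Mathlib
import HarnessLib

/-!
# The constant (first-order) a priori enclosure test for an ODE step

Topic `Literature/Analysis/ODE`. The validation step of interval (Taylor-series) methods for the
initial value problem `y' = f(y)`, `y(0) = y₀`, in its original first-order form, R. E. Moore,
*Methods and Applications of Interval Analysis* (SIAM 1979) [Moore1979], §8.1, eqs. (8.2)–(8.5):
with the interval Picard operator `P(X)(t) = y₀ + ∫₀ᵗ F(X(s)) ds` and a **constant** box `X ≡ S`,
the inclusion `P(S)(t) ⊆ S` for `0 ≤ t ≤ h` — i.e. `y₀ + [0, h] · F ⊆ S`, where the box `F ⊇ f(S)` is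
an interval evaluation of `f` over `S` — proves that the problem has a unique solution on the whole
step `[0, h]`, that the solution stays in `S`, and that it even stays in the tighter set
`P(S)(t) = y₀ + t · F` (Moore 1979, §8.1: "the solution will also be contained in `P(B)(t)`"). This is
"Algorithm I" of the survey of Nedialkov–Jackson–Corliss [NedialkovJacksonCorliss1999] (after Moore,
Eijgenraam, Lohner), the order-one member of the family of a priori enclosure tests with which
validated ODE solvers certify a step.

Moore derives the statement from his interval fixed-point Theorem 5.7 under the contraction condition
`L·h < 1`; the statement proved here has **no step-size restriction** beyond the inclusion itself (the
form in use since Eijgenraam 1981 / Lohner 1988). Proof: run Mathlib's Picard–Lindelöf theorem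
(`IsPicardLindelof`, which iterates the Picard operator until it contracts, so any Lipschitz constant
is allowed) for a globally Lipschitz, bounded modification `g` of `f` that agrees with `f` on `S` and
takes values in `F` (McShane extension of `f|S`, `LipschitzOnWith.extend_pi`, clamped coordinatewise
into the box `F`); then `Convex.set_average_mem` shows that the solution `y` of `y' = g(y)` satisfies
`y(t) ∈ y₀ + t · F ⊆ S`, so `g(y(t)) = f(y(t))` and `y` solves the original equation. Uniqueness
(every solution issued from `y₀` is this one, hence enclosed) is Mathlib's Gronwall-based
`ODE_solution_unique_of_mem_Icc_right`.

USE: this is the theorem behind the step-validation check of certified ODE integrators: an a priori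
enclosure `Y` of a step of length `h` from the box `W` is accepted iff `W + [0, h] · f(Y) ⊆ Y`
(order one; the `cap.ode` certificate semantics V2 of the engines programme use the order-`K`
Taylor form of the same test, whose `K = 1` case is the present statement).

## Main results (all in `Literature.Analysis.ODE`)

* `mem_smul_of_hasDerivWithinAt_of_mem` — if `y' = g(y)` on `[0, h]` and `g ∘ y` takes values in a
  closed convex `F`, then `y t ∈ y 0 + t • F`.
* `exists_solution_mem_smul_of_lipschitz` — Banach-space core: `g` globally Lipschitz with values in
  a closed convex bounded `F`; a solution of `y' = g(y)`, `y 0 = y₀` exists on `[0, h]` with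
  `y t ∈ y₀ + t • F`.
* `exists_solution_of_constantEnclosure` — Moore's test in `ℝ^ι`: `f` Lipschitz on `S`,
  `f(S) ⊆ [c, d]`, `y₀ + t • v ∈ S` for all `t ∈ [0, h]`, `v ∈ [c, d]` ⟹ a solution of `y' = f(y)`,
  `y 0 = y₀` exists on `[0, h]`, with `y t = y₀ + t • vₜ`, `vₜ ∈ [c, d]`, in particular `y t ∈ S`.
* `solution_mem_of_constantEnclosure` — under the same test, if `f` is Lipschitz on bounded sets
  then EVERY solution on `[0, h]` issued from `y₀` is so enclosed (uniqueness).
* `constantEnclosure_step` — the test for a box `W` of initial values, as used per step.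

## References

* [Moore1979] R. E. Moore, *Methods and Applications of Interval Analysis*, SIAM Studies in Applied
  Mathematics 2 (1979), §8.1, eqs. (8.2)–(8.5) (with Theorem 5.7). doi:10.1137/1.9781611970906
* [NedialkovJacksonCorliss1999] N. S. Nedialkov, K. R. Jackson, G. F. Corliss, Validated solutions of
  initial value problems for ordinary differential equations, Appl. Math. Comput. 105 (1999) 21–68,
  Algorithm I. doi:10.1016/S0096-3003(98)10083-8
-/

noncomputable section

open Set Metric MeasureTheory Filter Topology

open scoped NNReal

namespace Literature.Analysis.ODE

section Core

variable {E : Type*} [NormedAddCommGroup E] [NormedSpace ℝ E] [CompleteSpace E]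

/-- **Increments lie in `t •` the value box.** If `y' = g(y)` on `[0, h]` (derivatives within
`[0, h]`), `g` is continuous and `g (y s) ∈ F` for a closed convex `F` and all `s ∈ [0, h]`, then
`y t ∈ y 0 + t • F` for every `t ∈ [0, h]`: the increment `y t - y 0 = ∫₀ᵗ g(y(s)) ds` is `t` times an
average of an `F`-valued function (Moore 1979, §8.1: the solution is contained in
`P(B)(t) = y₀ + ∫₀ᵗ F(B) ds`). [cite: Moore1979, §8.1 eqs. (8.2)–(8.5)] -/
theorem mem_smul_of_hasDerivWithinAt_of_mem {g : E → E} (hgc : Continuous g) {F : Set E}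
    (hFc : Convex ℝ F) (hFcl : IsClosed F) {y : ℝ → E} {h : ℝ}
    (hy : ∀ t ∈ Icc 0 h, HasDerivWithinAt y (g (y t)) (Icc 0 h) t)
    (hgF : ∀ t ∈ Icc 0 h, g (y t) ∈ F) {t : ℝ} (ht : t ∈ Icc 0 h) :
    ∃ v ∈ F, y t = y 0 + t • v := by
  rcases eq_or_lt_of_le ht.1 with rfl | ht0
  · exact ⟨g (y 0), hgF 0 ht, by simp⟩
  have hcont : ContinuousOn y (Icc 0 t) := fun s hs =>
    ((hy s ⟨hs.1, hs.2.trans ht.2⟩).continuousWithinAt).mono (Icc_subset_Icc_right ht.2)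
  have hG : ContinuousOn (fun s => g (y s)) (Icc 0 t) := hgc.comp_continuousOn hcont
  have hderiv : ∀ s ∈ Ioo 0 t, HasDerivAt y (g (y s)) s := fun s hs =>
    (hy s ⟨hs.1.le, hs.2.le.trans ht.2⟩).hasDerivAt (Icc_mem_nhds hs.1 (hs.2.trans_le ht.2))
  -- fundamental theorem of calculus on `[0, t]`
  have hFTC : ∫ s in (0 : ℝ)..t, g (y s) = y t - y 0 :=
    intervalIntegral.integral_eq_sub_of_hasDerivAt_of_le ht0.le hcont hderiv
      (hG.intervalIntegrable_of_Icc ht0.le)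
  -- the average of `g ∘ y` over `(0, t]` lies in `F`
  have h0 : volume (Ioc (0 : ℝ) t) ≠ 0 := by
    rw [Real.volume_Ioc]
    simp only [sub_zero, ne_eq, ENNReal.ofReal_eq_zero, not_le]
    exact ht0
  have htop : volume (Ioc (0 : ℝ) t) ≠ ⊤ := by
    rw [Real.volume_Ioc]; exact ENNReal.ofReal_ne_top
  have hfs : ∀ᵐ s ∂(volume.restrict (Ioc (0 : ℝ) t)), g (y s) ∈ F := by
    filter_upwards [ae_restrict_mem measurableSet_Ioc] with s hs
    exact hgF s ⟨hs.1.le, hs.2.trans ht.2⟩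
  have hfi : IntegrableOn (fun s => g (y s)) (Ioc (0 : ℝ) t) volume :=
    (hG.integrableOn_Icc).mono_set Ioc_subset_Icc_self
  have hv : (⨍ s in Ioc (0 : ℝ) t, g (y s)) ∈ F := hFc.set_average_mem hFcl h0 htop hfs hfi
  refine ⟨⨍ s in Ioc (0 : ℝ) t, g (y s), hv, ?_⟩
  have hreal : volume.real (Ioc (0 : ℝ) t) = t := by
    rw [Real.volume_real_Ioc_of_le ht0.le, sub_zero]
  rw [MeasureTheory.setAverage_eq, hreal, smul_smul, mul_inv_cancel₀ ht0.ne', one_smul,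
    ← intervalIntegral.integral_of_le ht0.le, hFTC]
  abel

/-- **Banach-space core of the constant enclosure test.** Let `g : E → E` be globally Lipschitz with
values in a closed convex set `F` on which `‖·‖ ≤ L`. Then for every `y₀` and `h ≥ 0` the problem
`y' = g(y)`, `y(0) = y₀` has a solution on `[0, h]` (Picard–Lindelöf, ball radius `L h`) and it satisfies
`y t ∈ y₀ + t • F` for `t ∈ [0, h]` (Moore 1979, §8.1, `P(B)(t) ⊆ B` with `B` the whole space and the
enclosure `x(t) ∈ P(B)(t)`). [cite: Moore1979, §8.1 eqs. (8.2)–(8.5)] -/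
theorem exists_solution_mem_smul_of_lipschitz {g : E → E} {K : ℝ≥0} (hg : LipschitzWith K g)
    {F : Set E} (hFc : Convex ℝ F) (hFcl : IsClosed F) {L : ℝ} (hL : ∀ v ∈ F, ‖v‖ ≤ L)
    (hgF : ∀ x, g x ∈ F) (y₀ : E) {h : ℝ} (hh : 0 ≤ h) :
    ∃ y : ℝ → E, y 0 = y₀ ∧ (∀ t ∈ Icc 0 h, HasDerivWithinAt y (g (y t)) (Icc 0 h) t) ∧
      ∀ t ∈ Icc 0 h, ∃ v ∈ F, y t = y₀ + t • v := by
  have hL0 : 0 ≤ L := (norm_nonneg _).trans (hL _ (hgF y₀))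
  set Lnn : ℝ≥0 := ⟨L, hL0⟩ with hLnn
  set hnn : ℝ≥0 := ⟨h, hh⟩ with hhnn
  have ht₀ : (0 : ℝ) ∈ Icc 0 h := ⟨le_rfl, hh⟩
  have hPL : IsPicardLindelof (fun _ : ℝ => g) (⟨0, ht₀⟩ : Icc 0 h) y₀ (Lnn * hnn) 0 Lnn K := by
    refine IsPicardLindelof.of_time_independent (fun x _ => hL _ (hgF x)) hg.lipschitzOnWith ?_
    simp [hLnn, hhnn, max_eq_left hh]
    exact le_rfl
  obtain ⟨y, hy0, hy⟩ := hPL.exists_eq_forall_mem_Icc_hasDerivWithinAt₀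
  refine ⟨y, hy0, hy, fun t ht => ?_⟩
  obtain ⟨v, hv, heq⟩ :=
    mem_smul_of_hasDerivWithinAt_of_mem hg.continuous hFc hFcl hy (fun t _ => hgF _) ht
  refine ⟨v, hv, ?_⟩
  rw [heq]
  exact congrArg (· + t • v) hy0

end Core

section Box

variable {ι : Type*} [Fintype ι]

/-- **Moore's constant a priori enclosure test (existence and enclosure).** Let `f : ℝ^ι → ℝ^ι` be
Lipschitz on a set `S` with `f(S)` contained in the box `[c, d]` (`c ≤ d`), and suppose
`y₀ + t • v ∈ S` for all `t ∈ [0, h]` and `v ∈ [c, d]` — i.e. `y₀ + [0, h] · [c, d] ⊆ S`, Moore's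
`P(B)(t) ⊆ B` for the constant box `B = S` with `F(B) = [c, d] ⊇ f(B)`. Then `y' = f(y)`,
`y(0) = y₀` has a solution on the WHOLE step `[0, h]`, and `y t = y₀ + t • vₜ` with `vₜ ∈ [c, d]`, in
particular `y t ∈ S`, for every `t ∈ [0, h]` (Moore 1979, §8.1; no condition `L h < 1` is needed).
[cite: Moore1979, §8.1 eqs. (8.2)–(8.5)] -/
theorem exists_solution_of_constantEnclosure {f : (ι → ℝ) → ι → ℝ} {S : Set (ι → ℝ)} {K : ℝ≥0}
    (hf : LipschitzOnWith K f S) {c d : ι → ℝ} (hcd : c ≤ d) (hfS : MapsTo f S (Icc c d))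
    {y₀ : ι → ℝ} {h : ℝ} (hh : 0 ≤ h) (hencl : ∀ t ∈ Icc 0 h, ∀ v ∈ Icc c d, y₀ + t • v ∈ S) :
    ∃ y : ℝ → ι → ℝ, y 0 = y₀ ∧ (∀ t ∈ Icc 0 h, HasDerivWithinAt y (f (y t)) (Icc 0 h) t) ∧
      ∀ t ∈ Icc 0 h, y t ∈ S ∧ ∃ v ∈ Icc c d, y t = y₀ + t • v := by
  classical
  -- McShane extension of `f|S`, clamped coordinatewise into the box `[c, d]`
  obtain ⟨g₁, hg₁K, hg₁eq⟩ := hf.extend_pi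
  set g : (ι → ℝ) → ι → ℝ := fun x i => max (min (g₁ x i) (d i)) (c i) with hg_def
  have hgF : ∀ x, g x ∈ Icc c d := fun x =>
    ⟨fun i => le_max_right _ _, fun i => max_le ((min_le_right _ _)) (hcd i)⟩
  have hgS : ∀ x ∈ S, g x = f x := by
    intro x hx
    have hfx : f x ∈ Icc c d := hfS hx
    funext i
    have h1 : g₁ x i = f x i := by rw [← hg₁eq hx]
    simp only [hg_def, h1, min_eq_left (hfx.2 i), max_eq_left (hfx.1 i)]
  have hgK : LipschitzWith K g := by
    refine LipschitzWith.of_dist_le_mul fun x y => (dist_pi_le_iff (by positivity)).2 fun i => ?_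
    have h1 : dist (g₁ x i) (g₁ y i) ≤ K * dist x y :=
      (dist_le_pi_dist (g₁ x) (g₁ y) i).trans (hg₁K.dist_le_mul x y)
    refine le_trans ?_ h1
    rw [Real.dist_eq, Real.dist_eq]
    calc |max (min (g₁ x i) (d i)) (c i) - max (min (g₁ y i) (d i)) (c i)|
        ≤ |min (g₁ x i) (d i) - min (g₁ y i) (d i)| := abs_max_sub_max_le_abs _ _ _
      _ ≤ max |g₁ x i - g₁ y i| |d i - d i| := abs_min_sub_min_le_max _ _ _ _
      _ = |g₁ x i - g₁ y i| := by simp [abs_nonneg]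
  -- a norm bound on the box
  obtain ⟨L, hL⟩ := isBounded_iff_forall_norm_le.1 (Metric.isBounded_Icc c d)
  obtain ⟨y, hy0, hy, hyF⟩ :=
    exists_solution_mem_smul_of_lipschitz hgK (convex_Icc c d) isClosed_Icc hL hgF y₀ hh
  refine ⟨y, hy0, fun t ht => ?_, fun t ht => ?_⟩
  · obtain ⟨v, hv, heq⟩ := hyF t ht
    have hyS : y t ∈ S := heq ▸ hencl t ht v hv
    have := hy t ht
    rwa [hgS _ hyS] at this
  · obtain ⟨v, hv, heq⟩ := hyF t ht
    exact ⟨heq ▸ hencl t ht v hv, v, hv, heq⟩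

/-- **Moore's constant a priori enclosure test (every solution is enclosed).** Under the test of
`exists_solution_of_constantEnclosure`, if `f` is moreover Lipschitz on every bounded set (e.g. `C¹`),
then EVERY solution `z` of `z' = f(z)` on `[0, h]` with `z(0) = y₀` satisfies `z t ∈ y₀ + t • [c, d] ⊆ S`
for all `t ∈ [0, h]`: the problem "has a unique solution contained in `X(t)`" and "the solution will also
be contained in `P(B)(t)`" (Moore 1979, §8.1). [cite: Moore1979, §8.1 eqs. (8.2)–(8.5)] -/
theorem solution_mem_of_constantEnclosure {f : (ι → ℝ) → ι → ℝ} {S : Set (ι → ℝ)} {K : ℝ≥0}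
    (hf : LipschitzOnWith K f S) (hloc : ∀ ρ : ℝ, ∃ K' : ℝ≥0, LipschitzOnWith K' f (closedBall 0 ρ))
    {c d : ι → ℝ} (hcd : c ≤ d) (hfS : MapsTo f S (Icc c d)) {y₀ : ι → ℝ} {h : ℝ} (hh : 0 ≤ h)
    (hencl : ∀ t ∈ Icc 0 h, ∀ v ∈ Icc c d, y₀ + t • v ∈ S) {z : ℝ → ι → ℝ} (hz0 : z 0 = y₀)
    (hz : ∀ t ∈ Icc 0 h, HasDerivWithinAt z (f (z t)) (Icc 0 h) t) {t : ℝ} (ht : t ∈ Icc 0 h) :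
    z t ∈ S ∧ ∃ v ∈ Icc c d, z t = y₀ + t • v := by
  obtain ⟨y, hy0, hy, hyS⟩ := exists_solution_of_constantEnclosure hf hcd hfS hh hencl
  have hyc : ContinuousOn y (Icc 0 h) := fun s hs => (hy s hs).continuousWithinAt
  have hzc : ContinuousOn z (Icc 0 h) := fun s hs => (hz s hs).continuousWithinAt
  obtain ⟨Cy, hCy⟩ := isCompact_Icc.exists_bound_of_continuousOn hyc
  obtain ⟨Cz, hCz⟩ := isCompact_Icc.exists_bound_of_continuousOn hzc
  obtain ⟨K', hK'⟩ := hloc (max Cy Cz)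
  -- one-sided derivatives from the derivatives within `[0, h]`
  have hnhds : ∀ s ∈ Ico (0 : ℝ) h, Icc 0 h ∈ 𝓝[≥] s := fun s hs =>
    mem_of_superset (Icc_mem_nhdsGE hs.2) (Icc_subset_Icc_left hs.1)
  have hEq : EqOn y z (Icc 0 h) :=
    ODE_solution_unique_of_mem_Icc_right (v := fun _ => f) (s := fun _ => closedBall 0 (max Cy Cz))
      (K := K') (fun _ _ => hK') hyc
      (fun s hs => (hy s (Ico_subset_Icc_self hs)).mono_of_mem_nhdsWithin (hnhds s hs))
      (fun s hs => mem_closedBall_zero_iff.2 ((hCy s (Ico_subset_Icc_self hs)).trans (le_max_left _ _)))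
      hzc
      (fun s hs => (hz s (Ico_subset_Icc_self hs)).mono_of_mem_nhdsWithin (hnhds s hs))
      (fun s hs => mem_closedBall_zero_iff.2 ((hCz s (Ico_subset_Icc_self hs)).trans (le_max_right _ _)))
      (hy0.trans hz0.symm)
  rw [← hEq ht]
  exact hyS t ht

/-- **The step form of the test** (a box `W` of initial values). If `f` is Lipschitz on `S` and on
bounded sets, `f(S) ⊆ [c, d]`, and `W + [0, h] · [c, d] ⊆ S` (Moore's `P(B) ⊆ B` for the interval
initial condition, §8.1 eq. (8.13)), then for every `y₀ ∈ W`: a solution of `y' = f(y)`, `y(0) = y₀` on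
`[0, h]` exists, and every such solution satisfies `y t ∈ y₀ + t • [c, d] ⊆ S` for `t ∈ [0, h]`
(Moore 1979, §8.1). [cite: Moore1979, §8.1 eqs. (8.2)–(8.5), (8.13)] -/
theorem constantEnclosure_step {f : (ι → ℝ) → ι → ℝ} {S W : Set (ι → ℝ)} {K : ℝ≥0}
    (hf : LipschitzOnWith K f S) (hloc : ∀ ρ : ℝ, ∃ K' : ℝ≥0, LipschitzOnWith K' f (closedBall 0 ρ))
    {c d : ι → ℝ} (hcd : c ≤ d) (hfS : MapsTo f S (Icc c d)) {h : ℝ} (hh : 0 ≤ h)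
    (hencl : ∀ y₀ ∈ W, ∀ t ∈ Icc 0 h, ∀ v ∈ Icc c d, y₀ + t • v ∈ S) {y₀ : ι → ℝ} (hy₀ : y₀ ∈ W) :
    (∃ y : ℝ → ι → ℝ, y 0 = y₀ ∧ ∀ t ∈ Icc 0 h, HasDerivWithinAt y (f (y t)) (Icc 0 h) t) ∧
      ∀ z : ℝ → ι → ℝ, z 0 = y₀ → (∀ t ∈ Icc 0 h, HasDerivWithinAt z (f (z t)) (Icc 0 h) t) →
        ∀ t ∈ Icc 0 h, z t ∈ S ∧ ∃ v ∈ Icc c d, z t = y₀ + t • v := by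
  refine ⟨?_, fun z hz0 hz t ht =>
    solution_mem_of_constantEnclosure hf hloc hcd hfS hh (hencl y₀ hy₀) hz0 hz ht⟩
  obtain ⟨y, hy0, hy, -⟩ := exists_solution_of_constantEnclosure hf hcd hfS hh (hencl y₀ hy₀)
  exact ⟨y, hy0, hy⟩

end Box

end Literature.Analysis.ODE
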